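import Literature.Analysis.SpecialFunctions.RiemannThetaBlockDiagonal
import HarnessLib

/-!
# Theta functions with characteristics of a decomposable period matrix factorise

Layer `Literature/Analysis/SpecialFunctions`; sequel of `RiemannThetaBlockDiagonal.lean`
(`riemannTheta_blockDiag`: `ϑ(z, Ω₁ ⊕ Ω₂) = ϑ(z₁, Ω₁) · ϑ(z₂, Ω₂)` for the block-diagonal period matrix
`Ω₁ ⊕ Ω₂ = Matrix.reindex finSumFinEquiv finSumFinEquiv (Matrix.fromBlocks Ω₁ 0 0 Ω₂)`, written behind the
hypothesis `hΩ : Ω = …`). Here the same for the theta functions WITH CHARACTERISTICS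
`ϑ[a; b](z, Ω)` of the tree (`riemannThetaChar`, Lange (3.10)):

* **`riemannThetaChar_blockDiag`** — `ϑ[a; b](z, Ω₁ ⊕ Ω₂) = ϑ[a₁; b₁](z₁, Ω₁) · ϑ[a₂; b₂](z₂, Ω₂)` for
  `a = (a₁, a₂)`, `b = (b₁, b₂)`, `z = (z₁, z₂)` (from `ϑ[a;b](z, Ω) = e(πi ᵗaΩa + 2πi ᵗa(z+b)) ϑ(z + Ωa + b, Ω)`,
  `riemannThetaChar_eq_cexp_mul_riemannTheta`, and the splitting of `Ωa`, `ᵗaΩa`, `ᵗa(z + b)` along the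
  blocks); `_of_posDef` for `Ωᵢ` in the Siegel upper half spaces;
* **`riemannThetaChar_blockDiag_zero`** — the THETA CONSTANTS with characteristics of `Ω₁ ⊕ Ω₂` are the
  products of those of the blocks.

Sources: S. Grushevsky, Y. Xie (2025), Remark 6.2 (held text `paper:arxiv-2504.20243`, p0034): "the theta
function is the product `θ(τ, z) = θ′(τ′, z′) · θ(τ″, z″)`" for `(A, Θ) = (A′, Θ′) × (A″, Θ″)`; H. Farkas,
S. Grushevsky, R. Salvati Manni (2021), §4 (arXiv:1710.02938 p. 11): "the theta constant of a diagonal period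
matrix decomposes as a product `θ[ε;δ](diag(t₁, …, t_g)) = θ[ε₁;δ₁](t₁) · … · θ[ε_g;δ_g](t_g)`" (the case of
`1 × 1` blocks, iterated; the tree's `RiemannThetaDiagonal.lean` has it for `[ε; δ] = [0; 0]`).

Theorems only; no definitions, no named facts, net debt `0`.

## References

* [GrushevskyXie2025] S. Grushevsky, Y. Xie, *Integrable systems approach to the Schottky problem and
  related questions*, arXiv:2504.20243 (2025), Remark 6.2.
* [FarkasGrushevskySalvatimanni2021] H. M. Farkas, S. Grushevsky, R. Salvati Manni, *An explicit solution
  to the weak Schottky problem*, Algebr. Geom. 8 (2021), §4 (arXiv:1710.02938, p. 11).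
* [LangeBirkenhake1992] H. Lange, Ch. Birkenhake, *Complex Abelian Varieties* (1992), §3.3.2 (3.10),
  §3.3.4 Exercise (5).
-/

noncomputable section

open Complex Real Filter Topology
open scoped Matrix

namespace Literature.Analysis.SpecialFunctions

variable {n₁ n₂ : ℕ}

/-! ### Splitting of `Ωa`, `ᵗaΩa` along the blocks -/

section Characteristics

variable {Ω₁ : Matrix (Fin n₁) (Fin n₁) ℂ} {Ω₂ : Matrix (Fin n₂) (Fin n₂) ℂ}
  {Ω : Matrix (Fin (n₁ + n₂)) (Fin (n₁ + n₂)) ℂ}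
  (hΩ : Ω = Matrix.reindex finSumFinEquiv finSumFinEquiv (Matrix.fromBlocks Ω₁ 0 0 Ω₂))

/-- A dot product over `Fin (n₁ + n₂)` splits into the two blocks. [folklore] -/
private theorem dotProduct_eq_add (v w : Fin (n₁ + n₂) → ℂ) :
    v ⬝ᵥ w = (fun i ↦ v (Fin.castAdd n₂ i)) ⬝ᵥ (fun i ↦ w (Fin.castAdd n₂ i)) +
      (fun i ↦ v (Fin.natAdd n₁ i)) ⬝ᵥ (fun i ↦ w (Fin.natAdd n₁ i)) :=
  Fin.sum_univ_add _

include hΩ in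
/-- `(Ω₁ ⊕ Ω₂) a = (Ω₁ a₁, Ω₂ a₂)`, first block. [cite: GrushevskyXie2025, Remark 6.2 (p0034)] -/
theorem blockDiag_mulVec_castAdd (a : Fin (n₁ + n₂) → ℂ) (i : Fin n₁) :
    (Ω *ᵥ a) (Fin.castAdd n₂ i) = (Ω₁ *ᵥ fun j ↦ a (Fin.castAdd n₂ j)) i := by
  subst hΩ
  simp [Matrix.mulVec, dotProduct, Fin.sum_univ_add]

include hΩ in
/-- `(Ω₁ ⊕ Ω₂) a = (Ω₁ a₁, Ω₂ a₂)`, second block. [cite: GrushevskyXie2025, Remark 6.2 (p0034)] -/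
theorem blockDiag_mulVec_natAdd (a : Fin (n₁ + n₂) → ℂ) (i : Fin n₂) :
    (Ω *ᵥ a) (Fin.natAdd n₁ i) = (Ω₂ *ᵥ fun j ↦ a (Fin.natAdd n₁ j)) i := by
  subst hΩ
  simp [Matrix.mulVec, dotProduct, Fin.sum_univ_add]

include hΩ in
/-- The quadratic form of `Ω₁ ⊕ Ω₂` on complex vectors splits: `ᵗa(Ω₁ ⊕ Ω₂)a = ᵗa₁Ω₁a₁ + ᵗa₂Ω₂a₂`.
[cite: GrushevskyXie2025, Remark 6.2 (p0034)] -/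
theorem dotProduct_blockDiag_mulVec (a : Fin (n₁ + n₂) → ℂ) :
    a ⬝ᵥ (Ω *ᵥ a) =
      (fun i ↦ a (Fin.castAdd n₂ i)) ⬝ᵥ (Ω₁ *ᵥ fun i ↦ a (Fin.castAdd n₂ i)) +
        (fun i ↦ a (Fin.natAdd n₁ i)) ⬝ᵥ (Ω₂ *ᵥ fun i ↦ a (Fin.natAdd n₁ i)) := by
  rw [dotProduct_eq_add]
  simp only [blockDiag_mulVec_castAdd hΩ, blockDiag_mulVec_natAdd hΩ]

variable (hΩ₁ : ∀ i j, Ω₁ i j = Ω₁ j i) (hΩ₂ : ∀ i j, Ω₂ i j = Ω₂ j i) {c₁ c₂ : ℝ} (hc₁ : 0 < c₁)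
  (hc₂ : 0 < c₂) (hY₁ : ∀ x : Fin n₁ → ℝ, c₁ * ∑ i, x i ^ 2 ≤ ∑ i, ∑ j, x i * (Ω₁ i j).im * x j)
  (hY₂ : ∀ x : Fin n₂ → ℝ, c₂ * ∑ i, x i ^ 2 ≤ ∑ i, ∑ j, x i * (Ω₂ i j).im * x j)

include hΩ hΩ₁ hΩ₂ hc₁ hc₂ hY₁ hY₂ in
/-- **Theta functions with characteristics of a decomposable period matrix factorise:
`ϑ[a; b](z, Ω₁ ⊕ Ω₂) = ϑ[a₁; b₁](z₁, Ω₁) · ϑ[a₂; b₂](z₂, Ω₂)`** (`a = (a₁, a₂)`, `b = (b₁, b₂)`,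
`z = (z₁, z₂)`; `Ωᵢ` symmetric with `Im Ωᵢ ≥ cᵢ > 0`) — by `ϑ[a;b](z, Ω) = e(…) ϑ(z + Ωa + b, Ω)` and
`riemannTheta_blockDiag`; in particular the theta constants with characteristics of `Ω₁ ⊕ Ω₂` are the
products of those of the blocks ("the theta constant of a diagonal period matrix decomposes as a product",
here for two blocks of any size). [cite: GrushevskyXie2025, Remark 6.2 (p0034)]
[cite: FarkasGrushevskySalvatimanni2021, §4 (arXiv p. 11)] -/
theorem riemannThetaChar_blockDiag (a b z : Fin (n₁ + n₂) → ℂ) :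
    riemannThetaChar a b Ω z =
      riemannThetaChar (fun i ↦ a (Fin.castAdd n₂ i)) (fun i ↦ b (Fin.castAdd n₂ i)) Ω₁
          (fun i ↦ z (Fin.castAdd n₂ i)) *
        riemannThetaChar (fun i ↦ a (Fin.natAdd n₁ i)) (fun i ↦ b (Fin.natAdd n₁ i)) Ω₂
          (fun i ↦ z (Fin.natAdd n₁ i)) := by
  have hΩs : ∀ i j, Ω i j = Ω j i := by
    subst hΩ
    exact blockDiag_symm Ω₁ Ω₂ hΩ₁ hΩ₂
  rw [riemannThetaChar_eq_cexp_mul_riemannTheta Ω hΩs, riemannThetaChar_eq_cexp_mul_riemannTheta Ω₁ hΩ₁,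
    riemannThetaChar_eq_cexp_mul_riemannTheta Ω₂ hΩ₂, riemannTheta_blockDiag hΩ hc₁ hc₂ hY₁ hY₂]
  have e₁ : (fun i ↦ (z + Ω *ᵥ a + b) (Fin.castAdd n₂ i)) =
      (fun i ↦ z (Fin.castAdd n₂ i)) + Ω₁ *ᵥ (fun i ↦ a (Fin.castAdd n₂ i)) +
        fun i ↦ b (Fin.castAdd n₂ i) := by
    funext i
    simp [blockDiag_mulVec_castAdd hΩ]
  have e₂ : (fun i ↦ (z + Ω *ᵥ a + b) (Fin.natAdd n₁ i)) =
      (fun i ↦ z (Fin.natAdd n₁ i)) + Ω₂ *ᵥ (fun i ↦ a (Fin.natAdd n₁ i)) +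
        fun i ↦ b (Fin.natAdd n₁ i) := by
    funext i
    simp [blockDiag_mulVec_natAdd hΩ]
  rw [e₁, e₂, dotProduct_blockDiag_mulVec hΩ a, dotProduct_eq_add a (z + b)]
  have hzb₁ : (fun i ↦ (z + b) (Fin.castAdd n₂ i)) =
      (fun i ↦ z (Fin.castAdd n₂ i)) + fun i ↦ b (Fin.castAdd n₂ i) := rfl
  have hzb₂ : (fun i ↦ (z + b) (Fin.natAdd n₁ i)) =
      (fun i ↦ z (Fin.natAdd n₁ i)) + fun i ↦ b (Fin.natAdd n₁ i) := rfl
  rw [hzb₁, hzb₂, mul_add, mul_add, add_add_add_comm, Complex.exp_add]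
  ring

variable (hpos₁ : (Matrix.of fun i j ↦ (Ω₁ i j).im).PosDef) (hpos₂ : (Matrix.of fun i j ↦ (Ω₂ i j).im).PosDef)

include hΩ hΩ₁ hΩ₂ hpos₁ hpos₂ in
/-- **`ϑ[a; b](z, Ω₁ ⊕ Ω₂) = ϑ[a₁; b₁](z₁, Ω₁) · ϑ[a₂; b₂](z₂, Ω₂)` for `Ωᵢ` in the Siegel upper half
spaces.** [cite: GrushevskyXie2025, Remark 6.2 (p0034)] [cite: FarkasGrushevskySalvatimanni2021, §4 (arXiv p. 11)] -/
theorem riemannThetaChar_blockDiag_of_posDef (a b z : Fin (n₁ + n₂) → ℂ) :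
    riemannThetaChar a b Ω z =
      riemannThetaChar (fun i ↦ a (Fin.castAdd n₂ i)) (fun i ↦ b (Fin.castAdd n₂ i)) Ω₁
          (fun i ↦ z (Fin.castAdd n₂ i)) *
        riemannThetaChar (fun i ↦ a (Fin.natAdd n₁ i)) (fun i ↦ b (Fin.natAdd n₁ i)) Ω₂
          (fun i ↦ z (Fin.natAdd n₁ i)) := by
  obtain ⟨c₁, hc₁, hY₁⟩ := exists_pos_mul_sum_sq_le_of_posDef_im Ω₁ hpos₁
  obtain ⟨c₂, hc₂, hY₂⟩ := exists_pos_mul_sum_sq_le_of_posDef_im Ω₂ hpos₂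
  exact riemannThetaChar_blockDiag hΩ hΩ₁ hΩ₂ hc₁ hc₂ hY₁ hY₂ a b z

include hΩ hΩ₁ hΩ₂ hpos₁ hpos₂ in
/-- **The theta constants with characteristics of `Ω₁ ⊕ Ω₂` are products:
`ϑ[a; b](0, Ω₁ ⊕ Ω₂) = ϑ[a₁; b₁](0, Ω₁) · ϑ[a₂; b₂](0, Ω₂)`.**
[cite: FarkasGrushevskySalvatimanni2021, §4 (arXiv p. 11)] [cite: GrushevskyXie2025, Remark 6.2 (p0034)] -/
theorem riemannThetaChar_blockDiag_zero (a b : Fin (n₁ + n₂) → ℂ) :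
    riemannThetaChar a b Ω 0 =
      riemannThetaChar (fun i ↦ a (Fin.castAdd n₂ i)) (fun i ↦ b (Fin.castAdd n₂ i)) Ω₁ 0 *
        riemannThetaChar (fun i ↦ a (Fin.natAdd n₁ i)) (fun i ↦ b (Fin.natAdd n₁ i)) Ω₂ 0 :=
  riemannThetaChar_blockDiag_of_posDef hΩ hΩ₁ hΩ₂ hpos₁ hpos₂ a b 0

end Characteristics

end Literature.Analysis.SpecialFunctions

end
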